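import Summits.BirchSwinnertonDyer.Rank1Residual.P2.KrizLiThirteenTwentyThree
import HarnessLib

/-!
# Cell `bsd-print-cf2` (D-0131 (2) PRINT TIER, leaf CornerF @ `p = 2`), typer ty2 — the (★)-CERTIFIED
# Kriz–Li base `4563a1` (`j = 0`, good at `2`, `K = ℚ(√−23)`) in the SETTING of Kriz–Li 2019 Thm 5.1 (2),
# every kernel-checkable hypothesis DISCHARGED (its class-mate `4563b1` is p3's `KrizLiCubeSumThirteenCurve`)

HONEST FRAMING. Sequel of `P2/KrizLiThirteenTwentyThree.lean` (same framing, same dictionary; the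
shared lemmas `factorization_conductorNorm_cubicA₃_eq_two`, `eq_three_pow_mul_pow_of_dvd` live there)
for the base `4563a1 = E₉₂₈₂₃ : y² + y = x³ + 92823` of conductor `4563 = 3³·13²` (the OTHER optimal
curve of that conductor with a certified (★), `4563b1 = E₄₂` — the class of the Sylvester cube-sum curve
`x³ + y³ = 13` — is prover p3's `P2/KrizLiCubeSumThirteenCurve.lean`, not repeated here), of analytic rank
one, good at `2`, with (★) CERTIFIED (not printed) at `K = ℚ(√−23)` by the cell's lit seat (dossier §14.4,
kit j282459; exact certificate §14.8, kit j286962). DISCHARGED IN THE KERNEL: global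
minimality, `N ∣ 4563` hence `N < 5000`, `ord₁₃ N = 2` hence `N = 3ᵏ·13²` and the sign clause for
`d > 0`, `d ≡ 1 (mod 12)`, `13 ∤ d`, a rational point of infinite order, the Heegner hypothesis
K-generically (`(d_K/3) = (d_K/13) = 1`) and at `d_K = −23`, the prime support of `2N`, the decidable
form of "`a_ℓ` odd"; `E(ℚ)[2] = 0`, `c₂ = 1` and Kriz–Li's local clause are the generic
`twoTorsion_cubicA₃` / `krizLi_loc_cubicA₃`. No named fact; nothing beyond kernel theorems about one
explicit curve; the leaf is OPEN AS A CLASS; (★) stays the consumer's displayed binder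
(`P2.HasKrizLiStarDatum curve4563a1 K`, p3's `KrizLiSmallCMBase`).

References: [KrizLi2019] Thm 5.1 (2) = arXiv:1606.03172 Thm 1.12, Def 4.1, Thm 4.3, Rem. 6.3;
[Cremona1997] Table 1 (4563a1); [SilvermanAEC2009] VII.1 Rem 1.1, VII.3.4, VII.5.1, VIII.6.7;
[Silverman1994] IV.10.2, IV.10.4, IV.11.1; [Marcus1977] Ch. 3 Thm 25; [CreutzMiller2012] Thm 1.1;
cell dossier §14.4.
-/

noncomputable section

open scoped Classical

open WeierstrassCurve NumberField Literature.NumberTheory.EllipticCurves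
  Literature.NumberTheory.EllipticCurves.Rank1Residual
  Literature.NumberTheory.EllipticCurves.ModularForms
  Summit.BirchSwinnertonDyer.Rank1Residual

set_option autoImplicit false

namespace Summit.BirchSwinnertonDyer.Rank1Residual.P2

open Summit.BirchSwinnertonDyer.BirchSwinnertonDyer.Theorems.ConductorBoundOfBadPrimes
  Literature.NumberTheory.EllipticCurves.Rank1Residual.X11RankOneCertificates IsDedekindDomain

/-! ## §1 `4563a1 = E₉₂₈₂₃ : y² + y = x³ + 92823` (`N = 4563 = 3³·13²`) -/

/-- **Cremona's `4563a1 = [0,0,1,0,92823]`** (`Δ = −27·13^10`; generator `(129, 1496)`; rank `1`;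
(★) certified at `K = ℚ(√−23)`, cell dossier §14.4 — NOT printed).
[cite: Cremona1997, Table 1 (curve 4563a1)] -/
abbrev curve4563a1 : WeierstrassCurve ℚ := cubicA₃ 92823

/-- **`4563a1` is globally minimal** (`|Δ| = 3³·13^10`, exponents `< 12`). [cite: SilvermanAEC2009, VII.1 Remark 1.1] -/
instance isGloballyMinimal_curve4563a1 : curve4563a1.IsGloballyMinimal :=
  X11b.isGloballyMinimal_of_krausCriterion_support 0 0 1 0 92823 [(3, 3, 3), (13, 2, 10)]
    (by intro t ht; simp only [List.mem_cons, List.not_mem_nil, or_false] at ht; rcases ht with rfl | rfl <;> norm_num)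
    (by decide +kernel) (by decide +kernel)

/-- **`N(4563a1) ∣ 4563 = 3³·13²`** (Ogg: `f₃ ≤ ord₃ Δ = 3`; `f_13 ≤ 2`). [cite: Silverman1994, IV.10.4 and IV.11.1] -/
theorem conductorNorm_curve4563a1_dvd : curve4563a1.conductorNorm ℤ ∣ 4563 :=
  conductorNorm_dvd_of_localBounds 0 0 1 0 92823 curve4563a1 rfl [(3, 3), (13, 10)]
    (by intro t ht; simp only [List.mem_cons, List.not_mem_nil, or_false] at ht; rcases ht with rfl | rfl <;> norm_num)
    (by decide +kernel) (by norm_num) (by decide +kernel)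

/-- `N(4563a1) < 5000` (Creutz–Miller's range). [folklore] -/
theorem conductorNorm_curve4563a1_lt : curve4563a1.conductorNorm ℤ < 5000 :=
  lt_of_le_of_lt (Nat.le_of_dvd (by norm_num) conductorNorm_curve4563a1_dvd) (by norm_num)

/-- `N(4563a1) ≠ 0`. [folklore] -/
instance neZero_conductorNorm_curve4563a1 : NeZero (curve4563a1.conductorNorm ℤ) :=
  ⟨(curve4563a1.conductorNorm_pos_holds).ne'⟩

/-- **`ord_13 N(4563a1) = 2`** (additive at `13`: `13^10 ∥ Δ`, `c₄ = 0`). [cite: SilvermanATAEC1994, Thm. IV.10.2] -/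
theorem factorization_conductorNorm_curve4563a1_q : (curve4563a1.conductorNorm ℤ).factorization 13 = 2 :=
  factorization_conductorNorm_cubicA₃_eq_two 92823 (by norm_num) (by norm_num) (n := 10) (by norm_num) (by norm_num)
    (by rw [cubicA₃Int_Δ]; norm_num) (by rw [cubicA₃Int_Δ]; norm_num)

/-- **`N(4563a1) = 3ᵏ · 13²`** for some `k` (Cremona: `k = 3`, not needed). [cite: Cremona1997, Table 1 (4563a1)] -/
theorem conductorNorm_curve4563a1_eq : ∃ k, curve4563a1.conductorNorm ℤ = 3 ^ k * 13 ^ 2 :=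
  eq_three_pow_mul_pow_of_dvd (i := 3) (by norm_num) (by norm_num) (by simpa using conductorNorm_curve4563a1_dvd)
    factorization_conductorNorm_curve4563a1_q

/-- A prime `ℓ ∉ {2, 3, 13}` does not divide `2N(4563a1)`. [folklore] -/
theorem not_dvd_two_mul_conductorNorm_curve4563a1 {ℓ : ℕ} (hℓ : ℓ.Prime) (h2 : ℓ ≠ 2) (h3 : ℓ ≠ 3)
    (hq : ℓ ≠ 13) : ¬ ℓ ∣ 2 * curve4563a1.conductorNorm ℤ := by
  intro h
  have h' : ℓ ∣ 2 * (3 ^ 3 * 13 ^ 2) := h.trans (mul_dvd_mul_left 2 (by simpa using conductorNorm_curve4563a1_dvd))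
  rcases (Nat.Prime.dvd_mul hℓ).mp h' with h | h
  · exact h2 ((Nat.prime_dvd_prime_iff_eq hℓ Nat.prime_two).mp h)
  · rcases (Nat.Prime.dvd_mul hℓ).mp h with h | h
    · exact h3 ((Nat.prime_dvd_prime_iff_eq hℓ Nat.prime_three).mp (hℓ.dvd_of_dvd_pow h))
    · exact hq ((Nat.prime_dvd_prime_iff_eq hℓ (by norm_num)).mp (hℓ.dvd_of_dvd_pow h))

/-- **`1 ≤ rank_ℤ 4563a1(ℚ)` IN THE KERNEL**: `2·(129, 1496)` has `x = 181129287 / 8958049` with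
the odd prime `41 ∣ 8958049`. [cite: SilvermanAEC2009, VII.3.4 and Thm. VIII.6.7] [cite: Cremona1997, Table 1 (4563a1: r = 1)] -/
theorem one_le_mordellWeilRank_curve4563a1 : 1 ≤ curve4563a1.mordellWeilRank := by
  haveI : Fact (Nat.Prime 41) := ⟨by norm_num⟩
  exact one_le_mordellWeilRank_of_dvd_den curve4563a1 41 (by norm_num) (x := 181129287 / 8958049)
    (y := 8511191690853 / 26811440657)
    (WeierstrassCurve.Affine.equation_iff_nonsingular.mp (by
      rw [WeierstrassCurve.Affine.equation_iff]; norm_num [cubicA₃]))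
    (by norm_num)

/-- **The Heegner hypothesis for `N(4563a1)` in ANY quadratic `K` with `(d_K/3) = (d_K/13) = 1`** (the
primes of `N ∣ 3³·13²` split in `K`). [cite: KrizLi2019, Thm. 5.1 hypothesis "K satisfies the Heegner hypothesis for N"] -/
theorem satisfiesHeegnerHypothesis_curve4563a1 {K : Type} [Field K] [NumberField K]
    (h2 : Module.finrank ℚ K = 2) (h3 : jacobiSym (NumberField.discr K) 3 = 1)
    (hq : jacobiSym (NumberField.discr K) 13 = 1) : SatisfiesHeegnerHypothesis (curve4563a1.conductorNorm ℤ) K := by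
  refine satisfiesHeegnerHypothesis_of_dvd h2 conductorNorm_curve4563a1_dvd (fun q hq' hqB _ => ?_)
    (fun h => absurd h (by norm_num))
  have h' : q ∣ 3 ^ 3 * 13 ^ 2 := by simpa using hqB
  rcases (Nat.Prime.dvd_mul hq').mp h' with h | h
  · rw [(Nat.prime_dvd_prime_iff_eq hq' Nat.prime_three).mp (hq'.dvd_of_dvd_pow h)]; exact h3
  · rw [(Nat.prime_dvd_prime_iff_eq hq' (by norm_num)).mp (hq'.dvd_of_dvd_pow h)]; exact hq

/-- **`a_ℓ(4563a1)` odd `⟺` an even number of cube roots of `-5940688 = −16·371293` in `𝔽_ℓ`** (`ℓ ∉ {2,3,13}`).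
[cite: KrizLi2019, Def. 4.1 ("Frob_ℓ of order 3", a_ℓ odd)] -/
theorem odd_frobeniusTrace_curve4563a1_iff {ℓ : ℕ} [NeZero ℓ] (hℓ : ℓ.Prime) (h2 : ℓ ≠ 2) (h3 : ℓ ≠ 3)
    (hq : ℓ ≠ 13) : Odd (curve4563a1.frobeniusTrace ℓ) ↔
      Even ((Finset.univ.filter fun x : ZMod ℓ => x ^ 3 = -5940688).card) := by
  have ha : ¬ (ℓ : ℤ) ∣ 4 * 92823 + 1 := by
    intro h
    have h' : (ℓ : ℤ) ∣ 13 ^ 5 := by norm_num at h ⊢; exact h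
    exact hq ((Nat.prime_dvd_prime_iff_eq hℓ (by norm_num)).mp
      (Int.natCast_dvd_natCast.mp (by exact_mod_cast (Nat.prime_iff_prime_int.mp hℓ).dvd_of_dvd_pow h')))
  have e : (-(16 * (4 * ((92823 : ℤ) : ZMod ℓ) + 1)) : ZMod ℓ) = -5940688 := by push_cast; norm_num
  rw [odd_frobeniusTrace_cubicA₃_iff 92823 hℓ h2 h3 ha, e]

/-- **The sign clause `χ_d(−N) = 1` for `4563a1`** for positive `d ≡ 1 (mod 12)` prime to `13`
(`N = 3ᵏ·13²`). [cite: KrizLi2019, Thm. 5.1 (2) condition "χ_d(−N) = 1"] -/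
theorem sign_mul_jacobiSym_conductorNorm_curve4563a1 {d : ℤ} (hd0 : 0 < d) (hd12 : d % 12 = 1)
    (hq : ¬ (13 : ℤ) ∣ d) : Int.sign d * jacobiSym (curve4563a1.conductorNorm ℤ) d.natAbs = 1 := by
  obtain ⟨k, hk⟩ := conductorNorm_curve4563a1_eq
  refine sign_mul_jacobiSym_eq_one_of_eq_pow_mul_sq hk hd0 hd12 ?_
  exact (Nat.Prime.coprime_iff_not_dvd (by norm_num : Nat.Prime 13)).mpr
    (fun h => hq (by exact_mod_cast Int.ofNat_dvd_left.mpr h))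

/-! ## §K The certified Heegner field `ℚ(√−23)` for `4563a1` (`sqrtField (−23)` facts are p3's, `KrizLiTwoFortyThreeCurve`) -/

/-- **Heegner hypothesis for `(4563a1, K)`, `d_K = −23`**: `(−23/3) = (−23/13) = 1`.
[cite: KrizLi2019, Thm. 5.1 hypothesis "K satisfies the Heegner hypothesis for N"] [cite: Marcus1977, Ch. 3 Thm. 25] -/
theorem satisfiesHeegnerHypothesis_curve4563a1_of_discr_eq {K : Type} [Field K] [NumberField K]
    (h2 : Module.finrank ℚ K = 2) (hdK : NumberField.discr K = -23) :
    SatisfiesHeegnerHypothesis (curve4563a1.conductorNorm ℤ) K :=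
  satisfiesHeegnerHypothesis_curve4563a1 h2 (by rw [hdK]; norm_num) (by rw [hdK]; norm_num)

end Summit.BirchSwinnertonDyer.Rank1Residual.P2
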